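import Literature.NumberTheory.EllipticCurves.PAdicMeasureInversionProofs
import Literature.NumberTheory.EllipticCurves.BernoulliMeasureProofs
import HarnessLib

/-!
# The Iwasawa–Mellin transform of a distribution on `ℤ_p^×` as a NAMED power series, and the
# 2-adic Kubota–Leopoldt numerator `G(T) = ∫_{ℤ₂^×} (1+T)^{ℓ(x)} d(χ₋₄E_{1,5})(x)` with its involute

Mazur–Tate–Teitelbaum (Invent. Math. 84 (1986), §I.11–I.13) attach to a bounded distribution `μ`
on `ℤ_p` the power series `L_μ(T) = ∫_{ℤ_p^×} (1 + T)^{ℓ(x)} dμ(x)` (`⟨x⟩ = γ^{ℓ(x)}`,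
`γ = 1 + p^{e₀}`), whose `k`-th coefficient `∫ (ℓ(x) choose k) dμ` is the limit of the Riemann sums
`∑_η ∑_{s mod pⁿ} μ(ηγ^s + p^{n+e₀}ℤ_p)·(s choose k)` (`η` over the Teichmüller representatives).
The tree proves everything about this transform (`PAdicMeasureTransform.lean`: convergence,
coefficient bound, constant term `μ(ℤ_p^×)`, values at the characters of `Γ`) but introduces it only
EXISTENTIALLY (`exists_powerSeries_of_bounded_distribution`), and names the Riemann sums only for
the Mazur–Swinnerton-Dyer measure (`padicLRiemannSum`, `padicLFunction`). Lang (*Cyclotomic Fields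
I and II*, Ch. 4 §1 Example 2, §3) writes the same transform `f`, `∫ u^s dν(u) = f(γ^s − 1)`, for
the measures `ν = θE_{1,c}` of Ch. 2 §2 / Ch. 4 §3: these are the numerators of the Kubota–Leopoldt
`p`-adic `L`-functions, "`L_p(1−s, χ) = −(1 − χ(c)⟨c⟩^s)⁻¹ M_p(χE_{1,c})(s)`" [Ch. 4 §3, PDF p. 84
L1–L4; Thm. 3.2 L12–L14] — in the tree for ODD `p`, again existentially
(`exists_transforms_bernoulliMeasure`, `exists_iwasawaFunction_of_bernoulliMeasure`).

This file NAMES the objects (definitions with bodies; no named fact, nothing asserted):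

* `distributionRiemannSum μ k n` and `distributionTransform μ = L_μ(T) ∈ ℚ_p⟦T⟧` for an arbitrary
  set function `μ : (n : ℕ) → ℤ/pⁿ → ℚ_p` and every prime `p` — the Riemann sums are, symbol for
  symbol, the `RS`/`hRS` shape of `PAdicMeasureTransform.lean`, so that all its theorems apply BY
  NAME (`tendsto_distributionRiemannSum`, `norm_coeff_distributionTransform_le`,
  `constantCoeff_distributionTransform`, `hasSum_coeff_distributionTransform_mul_pow`), and
  `padicLRiemannSum f α = distributionRiemannSum (msdMeasure f α)`,
  `padicLFunction f α = distributionTransform (msdMeasure f α)` hold by `rfl`;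
* `chiMinusFour p : ℕ → ℤ_p`, the character `χ₋₄` extended by `0` (Mathlib's `ZMod.χ₄` read on `ℕ`
  and cast to `ℤ_p`), the `θ` of `bernoulliMeasure` at level `N = 4`;
* at `p = 2`: the measure `klTwoMeasure = χ₋₄·E_{1,5} = bernoulliMeasure 2 4 5 χ₋₄ 1` on `ℤ₂`, its
  inversion `klTwoMeasureInv = (χ₋₄E_{1,5})ˇ` under `x ↦ x⁻¹` on `ℤ₂^×` (the tree's `invUnitsDist`),
  the **2-adic Kubota–Leopoldt numerator** `klTwoNumerator = G(T) = ∫_{ℤ₂^×}(1+T)^{ℓ(x)} d(χ₋₄E_{1,5})(x)`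
  and its **involute** `klTwoNumeratorInv = G(T^ι) = ∫ (1+T)^{−ℓ(x)} d(χ₋₄E_{1,5})(x)`,
  `T^ι = (1+T)⁻¹ − 1` — with, PROVED: the distribution relation and the bound `‖·‖₂ ≤ 1` for both
  measures (`E_{1,c}^{(M)}(b) = (c−1)/2 − t` is `p`-integral for every ODD `c` at every `p`,
  `norm_regBernoulliDist_one_le_one_of_odd` — the tree's `norm_regBernoulliDist_one_le_one` assumed
  `p ≠ 2`), hence convergence of the Riemann sums to the coefficients of `G`, `G^ι`, the bound
  `‖[T^k]G‖₂ ≤ 1`, and `G(0) = G^ι(0) = (χ₋₄E_{1,5})(ℤ₂^×)`.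

Requested: harness item `defn-KubotaLeopoldtTwoNumerator` (planner bsd-rank2-p2 GEN 19, for the crux
`stmt-BirchSwinnertonDyer-20341`, line "star": the mod-2 Eisenstein identity (★) and the witness
(K) "`½G ∈ Λ` with odd constant term" are to be stated over tree names; sketch
`run/shared/lean/pub/bsd-rank2/p2/g19/DepletedLambdaLawAtTwoMod_star.lean` §D1, whose local
`chiFour`, `klTwoMeasure`, `klTwoMeasureInv n a = μ n a⁻¹`, `riemannSumTwo`, `klTwoNumerator`,
`klTwoNumeratorInv` are, respectively, `chiMinusFour 2` (`chiMinusFour_eq_ite`), `klTwoMeasure`,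
`klTwoMeasureInv` (= the sketch's on unit classes, `klTwoMeasureInv_apply_of_isUnit`; `0` instead of
junk on the non-unit classes, which the Riemann sums never sample), `distributionRiemannSum` at
`p = 2`, `klTwoNumerator`, `klTwoNumeratorInv`). Nothing about elliptic curves, (★) or BSD is
asserted here; no instance, no notation, no `sorry`.

§5 (appended; planner bsd-rank2-p2 GEN 19's stub (K) `KlTwoWitness` of line `star`, director-bsd g9
ruling (R3)): **at `p = 2` the measure `χ₋₄E_{1,5}` is EVEN** (`χ₋₄` and `E_{1,5}` are both odd:
`klTwoMeasure_neg`, `klTwoMeasureInv_neg`), so the two halves `η = ±1` of every Riemann sum agree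
(`distributionRiemannSum_two_of_even`: `RS_μ(k,n) = 2·∑_s μ(5^s + 2^{n+2}ℤ₂)(s choose k)` for any
even `μ`), whence **`‖[T^k]G‖₂ ≤ ½`, `‖[T^k]G^ι‖₂ ≤ ½`** (`norm_coeff_klTwoNumerator(Inv)_le_half`:
`G, G^ι ∈ 2Λ`), and **`G(0) = G^ι(0) = 2`** (`constantCoeff_klTwoNumerator(Inv)_eq_two`: total mass
`μ(ℤ₂) = E_{1,5}^{(4)}(1) − E_{1,5}^{(4)}(3) = 1 − (−1) = 2`, `μ(1 + 4ℤ₂) = 1`); packaged as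
`exists_iwasawa_half_klTwoNumerator(Inv)`: **`½G = ι(G₀)`, `½G^ι = ι(G₀^ι)` with `G₀, G₀^ι ∈ Λ = ℤ₂⟦T⟧`
of constant term `1`** — the classical normalisation of the `2`-adic Kubota–Leopoldt series
(Washington §7.2 divides by `2` at `p = 2`; numerically `G₀ ≡ 1 + T² + T⁵ + T⁷ + … (mod 2)`,
planner's kit data). No definition is added in §5.

## References

* B. Mazur, J. Tate, J. Teitelbaum, *On `p`-adic analogues of the conjectures of Birch and
  Swinnerton-Dyer*, Invent. Math. 84 (1986) 1–48, §I.11 (measures), §I.12, §I.13 (the transform and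
  its Riemann sums). [MazurTateTeitelbaum1986Invent]
* S. Lang, *Cyclotomic Fields I and II*, GTM 121, Springer 1990, Ch. 2 §2 (`E_{k,c}`, Thm. 2.1;
  PDF pp. 34–36), Ch. 4 §1 Example 2 (PDF p. 79), Ch. 4 §3 (`L_p`, Thm. 3.2; PDF p. 84) — held text
  `book:lang1990-cyclotomic-fields-i-ii`. [LangCyclotomic1990]
* L. C. Washington, *Introduction to Cyclotomic Fields*, GTM 83, §7.2 (`p = 2`: `q = 4`, `γ = 5`),
  §12.2.
-/

noncomputable section

open scoped Classical

open Filter Topology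

namespace Literature.NumberTheory.EllipticCurves

/-! ## §1 The Riemann sums and the transform of a distribution, named -/

section Transform

variable {p : ℕ} [Fact p.Prime]

/-- **The `n`-th Riemann sum for the `k`-th coefficient of the transform of `μ`**
(Mazur–Tate–Teitelbaum 1986, §I.13): `RS_μ(k, n) = ∑_η ∑_{s mod pⁿ} μ(η γ^s + p^{n+e₀}ℤ_p)·(s choose k)`,
`η` over the Teichmüller representatives `rootsOfUnity (torsionOrder p) ℤ_p` (`{±1}` for `p = 2`),
`γ = cyclotomicGenerator p` (`= 5` for `p = 2`), `e₀ = cyclotomicExponent p` (`= 2` for `p = 2`),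
`s` represented by `s.val ∈ [0, pⁿ)` — a Riemann sum for `∫_{ℤ_p^×} (ℓ(x) choose k) dμ(x)`. This is
VERBATIM the expression `RS k n` over which `PAdicMeasureTransform.lean` is written (its hypothesis
`hRS` is `distributionRiemannSum_spec μ`), and `padicLRiemannSum f α` is its instance at
`μ = msdMeasure f α` (`padicLRiemannSum_eq_distributionRiemannSum`, `rfl`).
[cite: MazurTateTeitelbaum1986Invent, §I.13] -/
def distributionRiemannSum (μ : (n : ℕ) → ZMod (p ^ n) → ℚ_[p]) (k n : ℕ) : ℚ_[p] :=
  ∑ᶠ η : rootsOfUnity (torsionOrder p) ℤ_[p], ∑ s : ZMod (p ^ n),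
    μ (n + cyclotomicExponent p)
        (PadicInt.toZModPow (n + cyclotomicExponent p) ((η : ℤ_[p]ˣ) : ℤ_[p]) *
          (cyclotomicGenerator p : ZMod (p ^ (n + cyclotomicExponent p))) ^ s.val) *
      ((s.val.choose k : ℕ) : ℚ_[p])

/-- **The transform `L_μ(T) = ∫_{ℤ_p^×} (1 + T)^{ℓ(x)} dμ(x) ∈ ℚ_p⟦T⟧` of a set function `μ` on
`ℤ_p`** (Mazur–Tate–Teitelbaum 1986, §I.13; Lang Ch. 4 §1 Example 2: the power series `f` with
`∫ u^s dν(u) = f(γ^s − 1)`), defined coefficientwise as the limit of the Riemann sums,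
`[T^k] L_μ = lim_n RS_μ(k, n) = ∫_{ℤ_p^×} (ℓ(x) choose k) dμ(x)` (`limUnder`; the limit exists when
`μ` satisfies the distribution relation and is bounded — `tendsto_distributionRiemannSum` —,
otherwise this is the junk value of `limUnder`). The power series produced existentially by
`exists_powerSeries_of_bounded_distribution` is this one; `padicLFunction f α` is its instance at
`μ = msdMeasure f α` (`padicLFunction_eq_distributionTransform`, `rfl`).
[cite: MazurTateTeitelbaum1986Invent, §I.13] -/
def distributionTransform (μ : (n : ℕ) → ZMod (p ^ n) → ℚ_[p]) : PowerSeries ℚ_[p] :=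
  PowerSeries.mk fun k ↦ limUnder atTop (distributionRiemannSum μ k)

variable (μ : (n : ℕ) → ZMod (p ^ n) → ℚ_[p])

/-- The Riemann sums in the `hRS` shape of `PAdicMeasureTransform.lean` (unfolding; feed this term
as the argument `hRS` of its theorems). [cite: MazurTateTeitelbaum1986Invent, §I.13 (unfolding)] -/
theorem distributionRiemannSum_spec : ∀ k n : ℕ, distributionRiemannSum μ k n =
    ∑ᶠ η : rootsOfUnity (torsionOrder p) ℤ_[p], ∑ s : ZMod (p ^ n),
      μ (n + cyclotomicExponent p)
          (PadicInt.toZModPow (n + cyclotomicExponent p) ((η : ℤ_[p]ˣ) : ℤ_[p]) *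
            (cyclotomicGenerator p : ZMod (p ^ (n + cyclotomicExponent p))) ^ s.val) *
        ((s.val.choose k : ℕ) : ℚ_[p]) :=
  fun _ _ ↦ rfl

/-- `[T^k] L_μ = lim_n RS_μ(k, n)` (unfolding). [cite: MazurTateTeitelbaum1986Invent, §I.13 (unfolding)] -/
theorem coeff_distributionTransform (k : ℕ) :
    PowerSeries.coeff k (distributionTransform μ) = limUnder atTop (distributionRiemannSum μ k) := by
  rw [distributionTransform, PowerSeries.coeff_mk]

/-- The tree's Riemann sums of the Mazur–Swinnerton-Dyer measure are the instance `μ = μ_{f,α}`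
(definitional). [cite: MazurTateTeitelbaum1986Invent, §I.13 (unfolding)] -/
theorem padicLRiemannSum_eq_distributionRiemannSum {N : ℕ}
    (f : CuspForm (CongruenceSubgroup.Gamma0 N) 2) (α : ℚ_[p]) :
    padicLRiemannSum f α = distributionRiemannSum (msdMeasure f α) :=
  rfl

/-- The tree's `p`-adic `L`-function `L_p(f, α, T)` is the transform of the Mazur–Swinnerton-Dyer
measure `μ_{f,α}` (definitional). [cite: MazurTateTeitelbaum1986Invent, §I.13 (unfolding)] -/
theorem padicLFunction_eq_distributionTransform {N : ℕ}
    (f : CuspForm (CongruenceSubgroup.Gamma0 N) 2) (α : ℚ_[p]) :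
    padicLFunction f α = distributionTransform (msdMeasure f α) :=
  rfl

variable {μ}

/-- **Convergence of the Riemann sums to the coefficients of the transform** for a bounded
distribution (`PAdicMeasureTransform.tendsto_riemannSum_of_distribution`, by name).
[cite: MazurTateTeitelbaum1986Invent, §I.11–I.13] -/
theorem tendsto_distributionRiemannSum
    (hdist : ∀ (n : ℕ) (a : ZMod (p ^ n)),
      ∑ b ∈ Finset.univ.filter (fun b : ZMod (p ^ (n + 1)) ↦
        ZMod.castHom (pow_dvd_pow p n.le_succ) (ZMod (p ^ n)) b = a), μ (n + 1) b = μ n a)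
    {C : ℝ} (hC : ∀ (n : ℕ) (a : ZMod (p ^ n)), ‖μ n a‖ ≤ C) (k : ℕ) :
    Tendsto (distributionRiemannSum μ k) atTop
      (𝓝 (PowerSeries.coeff k (distributionTransform μ))) := by
  rw [coeff_distributionTransform]
  exact tendsto_riemannSum_of_distribution (distributionRiemannSum_spec μ) hdist hC k

/-- **The coefficients of the transform of a distribution bounded by `C` have norm `≤ C`**
(`L_μ ∈ Λ ⊗ ℚ_p`; MTT §I.12) — `norm_limUnder_riemannSum_le_of_distribution` by name.
[cite: MazurTateTeitelbaum1986Invent, §I.12] -/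
theorem norm_coeff_distributionTransform_le
    (hdist : ∀ (n : ℕ) (a : ZMod (p ^ n)),
      ∑ b ∈ Finset.univ.filter (fun b : ZMod (p ^ (n + 1)) ↦
        ZMod.castHom (pow_dvd_pow p n.le_succ) (ZMod (p ^ n)) b = a), μ (n + 1) b = μ n a)
    {C : ℝ} (hC : ∀ (n : ℕ) (a : ZMod (p ^ n)), ‖μ n a‖ ≤ C) (k : ℕ) :
    ‖PowerSeries.coeff k (distributionTransform μ)‖ ≤ C := by
  rw [coeff_distributionTransform]
  exact norm_limUnder_riemannSum_le_of_distribution (distributionRiemannSum_spec μ) hdist hC k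

/-- **The constant term of the transform is `μ(ℤ_p^×) = ∑_{u ∈ (ℤ/p^{e₀})^×} μ(u + p^{e₀}ℤ_p)`**
(MTT §I.13; the Riemann sums for `k = 0` are constant, `riemannSum_zero_of_distribution`).
[cite: MazurTateTeitelbaum1986Invent, §I.13] -/
theorem constantCoeff_distributionTransform
    (hdist : ∀ (n : ℕ) (a : ZMod (p ^ n)),
      ∑ b ∈ Finset.univ.filter (fun b : ZMod (p ^ (n + 1)) ↦
        ZMod.castHom (pow_dvd_pow p n.le_succ) (ZMod (p ^ n)) b = a), μ (n + 1) b = μ n a) :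
    PowerSeries.constantCoeff (distributionTransform μ) =
      ∑ u : (ZMod (p ^ cyclotomicExponent p))ˣ, μ (cyclotomicExponent p) u := by
  rw [← PowerSeries.coeff_zero_eq_constantCoeff_apply, coeff_distributionTransform]
  exact (tendsto_const_nhds.congr fun n ↦
    (riemannSum_zero_of_distribution (distributionRiemannSum_spec μ) hdist n).symm).limUnder_eq

/-- **The values of the transform at the characters of `Γ`** (MTT §I.13–I.14): for `χ` mod
`p^{m+1}`, even and of `p`-power order, `∑_k [T^k]L_μ · (χ(γ) − 1)^k = ∑_{a mod p^{m+1}} χ(a) μ(a + p^{m+1}ℤ_p)`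
in `ℂ_p` — `hasSum_limUnder_riemannSum_mul_pow_of_distribution` by name.
[cite: MazurTateTeitelbaum1986Invent, §I.13–I.14 (14.3)] -/
theorem hasSum_coeff_distributionTransform_mul_pow
    (hdist : ∀ (n : ℕ) (a : ZMod (p ^ n)),
      ∑ b ∈ Finset.univ.filter (fun b : ZMod (p ^ (n + 1)) ↦
        ZMod.castHom (pow_dvd_pow p n.le_succ) (ZMod (p ^ n)) b = a), μ (n + 1) b = μ n a)
    {C : ℝ} (hC : ∀ (n : ℕ) (a : ZMod (p ^ n)), ‖μ n a‖ ≤ C)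
    {m : ℕ} (χ : DirichletCharacter ℂ_[p] (p ^ (m + 1))) (heven : χ.Even)
    (hord : ∃ j : ℕ, orderOf χ = p ^ j) :
    HasSum (fun k : ℕ ↦ algebraMap ℚ_[p] ℂ_[p] (PowerSeries.coeff k (distributionTransform μ)) *
        (χ (cyclotomicGenerator p : ZMod (p ^ (m + 1))) - 1) ^ k)
      (∑ a : ZMod (p ^ (m + 1)), χ a * algebraMap ℚ_[p] ℂ_[p] (μ (m + 1) a)) := by
  simp only [coeff_distributionTransform]
  exact hasSum_limUnder_riemannSum_mul_pow_of_distribution (distributionRiemannSum_spec μ) hdist hC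
    χ heven hord

end Transform

/-! ## §2 The character `χ₋₄` extended by zero, as the `θ` of `bernoulliMeasure` -/

section ChiMinusFour

variable (p : ℕ) [Fact p.Prime]

/-- **`χ₋₄` extended by `0`**, as a `4`-periodic function `ℕ → ℤ_p`: `1, 0, −1, 0` on `1, 2, 3, 0 mod 4`
(Mathlib's quadratic character `ZMod.χ₄` read on `ℕ` and cast into `ℤ_p`); the `θ` of
`bernoulliMeasure p 4 c θ k` (Lang Ch. 4 §3: the measure `χE_{1,c}` with `χ` "extended by `0`").
At `p = 2` this is also the Teichmüller character `ω`.
[cite: LangCyclotomic1990, Ch. 4 §3 (the measure χE_{1,c}, χ extended by 0; PDF p. 84)] -/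
def chiMinusFour (b : ℕ) : ℤ_[p] := ((ZMod.χ₄ (b : ZMod 4) : ℤ) : ℤ_[p])

/-- `χ₋₄(b) = 1, −1, 0` according as `b ≡ 1, 3, {0, 2} (mod 4)` (the shape of the requester's sketch).
[cite: LangCyclotomic1990, Ch. 2 §2 (characters χ on Z(m)^*, PDF p. 36) and Ch. 4 §3 (χE_{1,c}, χ extended by 0, PDF p. 84) (unfolding of Mathlib's `ZMod.χ₄`)] -/
theorem chiMinusFour_eq_ite (b : ℕ) :
    chiMinusFour p b = if b % 4 = 1 then 1 else if b % 4 = 3 then -1 else 0 := by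
  unfold chiMinusFour
  split_ifs with h1 h3
  · rw [ZMod.χ₄_nat_one_mod_four h1, Int.cast_one]
  · rw [ZMod.χ₄_nat_three_mod_four h3, Int.cast_neg, Int.cast_one]
  · rw [ZMod.χ₄_nat_eq_if_mod_four, if_pos (by omega), Int.cast_zero]

/-- `χ₋₄` has period `4` (a character modulo `4`). [cite: LangCyclotomic1990, Ch. 2 §2 (characters χ on Z(m)^*, PDF p. 36) and Ch. 4 §3 (χE_{1,c}, χ extended by 0, PDF p. 84) (unfolding of Mathlib's `ZMod.χ₄`)] -/
theorem chiMinusFour_add_four (b : ℕ) : chiMinusFour p (b + 4) = chiMinusFour p b := by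
  unfold chiMinusFour
  rw [ZMod.χ₄_nat_mod_four (b + 4), ZMod.χ₄_nat_mod_four b, Nat.add_mod_right]

/-- `χ₋₄` vanishes on the even numbers (in particular on the multiples of `p` when `p = 2`).
[cite: LangCyclotomic1990, Ch. 2 §2 (characters χ on Z(m)^*, PDF p. 36) and Ch. 4 §3 (χE_{1,c}, χ extended by 0, PDF p. 84) (unfolding of Mathlib's `ZMod.χ₄`)] -/
theorem chiMinusFour_eq_zero_of_two_dvd {b : ℕ} (h : 2 ∣ b) : chiMinusFour p b = 0 := by
  unfold chiMinusFour
  rw [ZMod.χ₄_nat_eq_if_mod_four, if_pos (Nat.mod_eq_zero_of_dvd h), Int.cast_zero]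

/-- `χ₋₄` is multiplicative. [cite: LangCyclotomic1990, Ch. 2 §2 (characters χ on Z(m)^*, PDF p. 36) and Ch. 4 §3 (χE_{1,c}, χ extended by 0, PDF p. 84) (unfolding of Mathlib's `ZMod.χ₄`)] -/
theorem chiMinusFour_mul (a b : ℕ) :
    chiMinusFour p (a * b) = chiMinusFour p a * chiMinusFour p b := by
  unfold chiMinusFour
  rw [Nat.cast_mul, map_mul, Int.cast_mul]

end ChiMinusFour

/-! ## §3 `E_{1,c}` is `p`-integral for odd `c`, at every `p` (Lang Ch. 2 §2 Thm. 2.1 (i), incl. `p = 2`) -/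

section Integrality

/-- **`E_{1,c}^{(M)}` is `p`-integral for every odd `c` prime to `M`, at EVERY prime `p`** (Lang
Ch. 2 §2, Thm. 2.1 (i) and its proof, PDF p. 36: "the expression for `E_{1,c}` is obviously
`N`-integral except possibly for the term `(c−1)/2`" — which is an integer for odd `c`): with
`regBernoulliDist_one_eq`, `E_{1,c}^{(M)}(b) = (c−1)/2 − t ∈ ℤ`. (The tree's
`norm_regBernoulliDist_one_le_one` covers odd `p` and any `c`; this covers `p = 2`.)
[cite: LangCyclotomic1990, Ch. 2 §2, Thm. 2.1 (i) (PDF p. 36)] -/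
theorem norm_regBernoulliDist_one_le_one_of_odd (p : ℕ) [Fact p.Prime] {M c : ℕ} [NeZero M]
    (hc : c.Coprime M) (hodd : Odd c) (b : ZMod M) :
    ‖((regBernoulliDist 1 M c b : ℚ) : ℚ_[p])‖ ≤ 1 := by
  obtain ⟨t, ht⟩ := exists_mul_val_mul_inv_eq hc b
  obtain ⟨d, hd⟩ := hodd
  have h : ((c : ℚ) - 1) / 2 - t = ((d : ℤ) - t : ℤ) := by
    rw [hd]; push_cast; ring
  rw [regBernoulliDist_one_eq b ht, h]
  exact_mod_cast Padic.norm_int_le_one ((d : ℤ) - t)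

/-- **`θE_{1,c}` is a measure bounded by `1` for odd `c`, at every `p`** (Lang Ch. 2 §2 Thm. 2.1 (i);
`θ` has values in `ℤ_p`; `ℚ_p` is non-archimedean) — the `p = 2` companion of
`norm_bernoulliMeasure_one_le_one`. [cite: LangCyclotomic1990, Ch. 2 §2, Thm. 2.1 (i) (PDF p. 36)] -/
theorem norm_bernoulliMeasure_one_le_one_of_odd (p : ℕ) [Fact p.Prime] {N : ℕ} [NeZero N] {c : ℕ}
    {θ : ℕ → ℤ_[p]} (hc : c.Coprime (N * p)) (hodd : Odd c) (n : ℕ) (a : ZMod (p ^ n)) :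
    ‖bernoulliMeasure p N c θ 1 n a‖ ≤ 1 := by
  have hc' : c.Coprime (N * p ^ n) :=
    Nat.Coprime.mul_right (Nat.Coprime.coprime_mul_right_right hc)
      (Nat.Coprime.pow_right _ (Nat.Coprime.coprime_mul_left_right hc))
  unfold bernoulliMeasure
  refine IsUltrametricDist.norm_sum_le_of_forall_le_of_nonneg zero_le_one fun b _ ↦ ?_
  rw [norm_mul, Nat.cast_one, div_one]
  calc _ ≤ (1 : ℝ) * 1 := by
        gcongr
        · exact (PadicInt.padic_norm_e_of_padicInt _).le.trans (PadicInt.norm_le_one _)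
        · exact norm_regBernoulliDist_one_le_one_of_odd p hc' hodd b
    _ = 1 := one_mul _

/-- **`θE_{k,c}` vanishes on the non-unit classes of positive level** when `θ` vanishes on the
multiples of `p` (every `b` in the fibre of a non-unit class `a` of level `n ≥ 1` is divisible by
`p`). [cite: LangCyclotomic1990, Ch. 4 §3 (χ extended by 0; the measure lives on ℤ_p^*, PDF p. 84)] -/
theorem bernoulliMeasure_apply_eq_zero_of_not_isUnit {p : ℕ} [Fact p.Prime] {N : ℕ} [NeZero N]
    {c : ℕ} {θ : ℕ → ℤ_[p]} (hθp : ∀ b, p ∣ b → θ b = 0) (k : ℕ) {n : ℕ} (hn : 1 ≤ n)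
    (a : ZMod (p ^ n)) (ha : ¬ IsUnit a) : bernoulliMeasure p N c θ k n a = 0 := by
  haveI : NeZero (p ^ n) := ⟨pow_ne_zero _ (Fact.out : p.Prime).ne_zero⟩
  have hpa : p ∣ a.val := by
    by_contra h
    apply ha
    have hcop : a.val.Coprime (p ^ n) :=
      Nat.Coprime.pow_right _ ((Nat.Prime.coprime_iff_not_dvd Fact.out).mpr h).symm
    have hu := (ZMod.isUnit_iff_coprime a.val (p ^ n)).mpr hcop
    rwa [ZMod.natCast_zmod_val] at hu
  unfold bernoulliMeasure
  refine Finset.sum_eq_zero fun b hb ↦ ?_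
  have hb' := (Finset.mem_filter.mp hb).2
  have hmod : b.val % p ^ n = a.val := by
    have h := congr_arg ZMod.val hb'
    rwa [ZMod.castHom_apply, ZMod.cast_eq_val, ZMod.val_natCast] at h
  have hdvd : p ∣ b.val := by
    rw [← Nat.mod_add_div b.val (p ^ n), hmod]
    exact dvd_add hpa (dvd_mul_of_dvd_left (dvd_pow_self p (by omega)) _)
  rw [hθp _ hdvd, PadicInt.coe_zero, zero_mul]

end Integrality

/-! ## §4 The 2-adic Kubota–Leopoldt numerator `G` and its involute `G^ι` -/

section KubotaLeopoldtTwo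

/-- **The measure `χ₋₄·E_{1,5}` on `ℤ₂`** (Lang Ch. 4 §3, the measure `θE_{1,c}` of the
Kubota–Leopoldt construction, at `p = 2`, level `N = 4`, `c = 5 = γ`, `k = 1`; tree
`bernoulliMeasure`): `μ(a + 2ⁿℤ₂) = ∑_{b mod 4·2ⁿ, b ≡ a (2ⁿ)} χ₋₄(b) E_{1,5}^{(4·2ⁿ)}(b)`.
[cite: LangCyclotomic1990, Ch. 4 §3 (the measure χE_{1,c}, PDF p. 84) and Ch. 2 §2 (E_{1,c}, PDF p. 35)] -/
def klTwoMeasure : (n : ℕ) → ZMod (2 ^ n) → ℚ_[2] :=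
  bernoulliMeasure 2 4 5 (chiMinusFour 2) 1

/-- **The inverted measure `(χ₋₄E_{1,5})ˇ`** — the push-forward of `χ₋₄E_{1,5}|_{ℤ₂^×}` under
`x ↦ x⁻¹` (tree `invUnitsDist`: `μ̌(a + 2ⁿℤ₂) = μ(a⁻¹ + 2ⁿℤ₂)` on unit classes, `0` on the others),
whose transform is the involute `G(T^ι)`, `T^ι = (1 + T)⁻¹ − 1`.
[cite: LangCyclotomic1990, Ch. 4 §2 (operations on measures, PDF pp. 80–82)] -/
def klTwoMeasureInv : (n : ℕ) → ZMod (2 ^ n) → ℚ_[2] :=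
  invUnitsDist klTwoMeasure

/-- **The 2-adic Kubota–Leopoldt numerator** `G(T) = ∫_{ℤ₂^×} (1 + T)^{ℓ(x)} d(χ₋₄E_{1,5})(x) ∈ ℚ₂⟦T⟧`
(`⟨x⟩ = 5^{ℓ(x)}`): the Mazur–Tate–Teitelbaum transform (`distributionTransform`, coefficientwise
limits of the Riemann sums over `η ∈ {±1}`, `s mod 2ⁿ`, classes `η·5^s + 2^{n+2}ℤ₂`) of the measure
`χ₋₄E_{1,5}` — Lang's power series `f` of the measure (Ch. 4 §1 Example 2), the numerator
`M_2(χE_{1,c})` of `L_2(1 − s, χ) = −(1 − χ(c)⟨c⟩^s)⁻¹ M_2(χE_{1,c})(s)` (Ch. 4 §3) at `c = 5`,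
read in the variable `T`. Its coefficients have norm `≤ 1` (`norm_coeff_klTwoNumerator_le_one`).
[cite: LangCyclotomic1990, Ch. 4 §1 Example 2 (PDF p. 79) and §3 (L_p, Thm. 3.2; PDF p. 84)]
[cite: MazurTateTeitelbaum1986Invent, §I.13] -/
def klTwoNumerator : PowerSeries ℚ_[2] :=
  distributionTransform klTwoMeasure

/-- **The involute** `G(T^ι) = ∫_{ℤ₂^×} (1 + T)^{−ℓ(x)} d(χ₋₄E_{1,5})(x) ∈ ℚ₂⟦T⟧`,
`T^ι = (1 + T)⁻¹ − 1`: the transform of the inverted measure `(χ₋₄E_{1,5})ˇ` (`ℓ(x⁻¹) = −ℓ(x)`).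
[cite: LangCyclotomic1990, Ch. 4 §1 Example 2 (PDF p. 79) and §2 (PDF pp. 80–82)]
[cite: MazurTateTeitelbaum1986Invent, §I.13] -/
def klTwoNumeratorInv : PowerSeries ℚ_[2] :=
  distributionTransform klTwoMeasureInv

/-- Unfolding of `klTwoMeasure`. [cite: LangCyclotomic1990, Ch. 4 §3 (unfolding)] -/
theorem klTwoMeasure_apply (n : ℕ) (a : ZMod (2 ^ n)) :
    klTwoMeasure n a = bernoulliMeasure 2 4 5 (chiMinusFour 2) 1 n a :=
  rfl

/-- On a unit class the inverted measure is `μ(a⁻¹ + 2ⁿℤ₂)` (the requester's sketch shape).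
[cite: LangCyclotomic1990, Ch. 4 §2 (unfolding)] -/
theorem klTwoMeasureInv_apply_of_isUnit {n : ℕ} {a : ZMod (2 ^ n)} (ha : IsUnit a) :
    klTwoMeasureInv n a = klTwoMeasure n a⁻¹ := by
  rw [klTwoMeasureInv, invUnitsDist, dif_pos ha, ← ZMod.inv_coe_unit, ha.unit_spec]

/-- Off the unit classes the inverted measure is `0`. [cite: LangCyclotomic1990, Ch. 4 §2 (unfolding)] -/
theorem klTwoMeasureInv_apply_of_not_isUnit {n : ℕ} {a : ZMod (2 ^ n)} (ha : ¬ IsUnit a) :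
    klTwoMeasureInv n a = 0 := by
  rw [klTwoMeasureInv, invUnitsDist, dif_neg ha]

/-- `[T^k] G = lim_n RS(k, n)` (unfolding). [cite: MazurTateTeitelbaum1986Invent, §I.13 (unfolding)] -/
theorem coeff_klTwoNumerator (k : ℕ) :
    PowerSeries.coeff k klTwoNumerator = limUnder atTop (distributionRiemannSum klTwoMeasure k) :=
  coeff_distributionTransform _ k

/-- `[T^k] G^ι = lim_n RSˇ(k, n)` (unfolding). [cite: MazurTateTeitelbaum1986Invent, §I.13 (unfolding)] -/
theorem coeff_klTwoNumeratorInv (k : ℕ) :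
    PowerSeries.coeff k klTwoNumeratorInv =
      limUnder atTop (distributionRiemannSum klTwoMeasureInv k) :=
  coeff_distributionTransform _ k

/-- **`χ₋₄E_{1,5}` satisfies the distribution relation** on the `2`-power tower (Lang Ch. 2 §2:
`E_{k,c}` is a distribution; `5` is prime to `4·2`, `χ₋₄` has period `4`).
[cite: LangCyclotomic1990, Ch. 2 §2, E_{k,c} and Thm. 2.1 (PDF pp. 35–36)] -/
theorem klTwoMeasure_distribution (n : ℕ) (a : ZMod (2 ^ n)) :
    ∑ b ∈ Finset.univ.filter (fun b : ZMod (2 ^ (n + 1)) ↦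
        ZMod.castHom (pow_dvd_pow 2 n.le_succ) (ZMod (2 ^ n)) b = a), klTwoMeasure (n + 1) b =
      klTwoMeasure n a :=
  sum_fiber_bernoulliMeasure (by norm_num) (chiMinusFour_add_four 2) le_rfl n a

/-- **`χ₋₄E_{1,5}` is a measure: `‖μ(a + 2ⁿℤ₂)‖₂ ≤ 1`** (`E_{1,5}^{(M)}(b) = 2 − t ∈ ℤ`; Lang Ch. 2 §2
Thm. 2.1 (i)). [cite: LangCyclotomic1990, Ch. 2 §2, Thm. 2.1 (i) (PDF p. 36)] -/
theorem norm_klTwoMeasure_le_one (n : ℕ) (a : ZMod (2 ^ n)) : ‖klTwoMeasure n a‖ ≤ 1 :=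
  norm_bernoulliMeasure_one_le_one_of_odd 2 (by norm_num) (by decide) n a

/-- `χ₋₄E_{1,5}` vanishes on the non-unit (even) classes of positive level (`χ₋₄` vanishes on even
numbers). [cite: LangCyclotomic1990, Ch. 4 §3 (χ extended by 0, PDF p. 84)] -/
theorem klTwoMeasure_eq_zero_of_not_isUnit {n : ℕ} (hn : 1 ≤ n) (a : ZMod (2 ^ n))
    (ha : ¬ IsUnit a) : klTwoMeasure n a = 0 :=
  bernoulliMeasure_apply_eq_zero_of_not_isUnit (fun _ h ↦ chiMinusFour_eq_zero_of_two_dvd 2 h) 1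
    hn a ha

/-- **The inverted measure satisfies the distribution relation** (tree `invUnitsDist_distribution`:
inversion commutes with the fibres of the tower for a distribution supported on the units).
[cite: LangCyclotomic1990, Ch. 4 §2 (operations on measures, PDF pp. 80–82)] -/
theorem klTwoMeasureInv_distribution (n : ℕ) (a : ZMod (2 ^ n)) :
    ∑ b ∈ Finset.univ.filter (fun b : ZMod (2 ^ (n + 1)) ↦
        ZMod.castHom (pow_dvd_pow 2 n.le_succ) (ZMod (2 ^ n)) b = a), klTwoMeasureInv (n + 1) b =
      klTwoMeasureInv n a :=
  invUnitsDist_distribution klTwoMeasure_distribution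
    (fun _ hn a ha ↦ klTwoMeasure_eq_zero_of_not_isUnit hn a ha) n a

/-- `‖(χ₋₄E_{1,5})ˇ(a + 2ⁿℤ₂)‖₂ ≤ 1`. [cite: LangCyclotomic1990, Ch. 4 §2 (PDF pp. 80–82)] -/
theorem norm_klTwoMeasureInv_le_one (n : ℕ) (a : ZMod (2 ^ n)) : ‖klTwoMeasureInv n a‖ ≤ 1 :=
  norm_invUnitsDist_le norm_klTwoMeasure_le_one n a

/-- **The Riemann sums of `χ₋₄E_{1,5}` converge to the coefficients of `G`.**
[cite: MazurTateTeitelbaum1986Invent, §I.11–I.13] -/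
theorem tendsto_distributionRiemannSum_klTwoMeasure (k : ℕ) :
    Tendsto (distributionRiemannSum klTwoMeasure k) atTop
      (𝓝 (PowerSeries.coeff k klTwoNumerator)) :=
  tendsto_distributionRiemannSum klTwoMeasure_distribution norm_klTwoMeasure_le_one k

/-- **The Riemann sums of `(χ₋₄E_{1,5})ˇ` converge to the coefficients of `G^ι`.**
[cite: MazurTateTeitelbaum1986Invent, §I.11–I.13] -/
theorem tendsto_distributionRiemannSum_klTwoMeasureInv (k : ℕ) :
    Tendsto (distributionRiemannSum klTwoMeasureInv k) atTop
      (𝓝 (PowerSeries.coeff k klTwoNumeratorInv)) :=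
  tendsto_distributionRiemannSum klTwoMeasureInv_distribution norm_klTwoMeasureInv_le_one k

/-- **`‖[T^k] G‖₂ ≤ 1`**: `G ∈ Λ ⊗ ℚ₂` with integral coefficients (MTT §I.12).
[cite: MazurTateTeitelbaum1986Invent, §I.12] -/
theorem norm_coeff_klTwoNumerator_le_one (k : ℕ) : ‖PowerSeries.coeff k klTwoNumerator‖ ≤ 1 :=
  norm_coeff_distributionTransform_le klTwoMeasure_distribution norm_klTwoMeasure_le_one k

/-- **`‖[T^k] G^ι‖₂ ≤ 1`.** [cite: MazurTateTeitelbaum1986Invent, §I.12] -/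
theorem norm_coeff_klTwoNumeratorInv_le_one (k : ℕ) :
    ‖PowerSeries.coeff k klTwoNumeratorInv‖ ≤ 1 :=
  norm_coeff_distributionTransform_le klTwoMeasureInv_distribution norm_klTwoMeasureInv_le_one k

/-- **`G(0) = (χ₋₄E_{1,5})(ℤ₂^×) = μ(1 + 4ℤ₂) + μ(3 + 4ℤ₂)`** (the constant term of the transform is
the total mass on the units; `e₀ = 2` at `p = 2`). [cite: MazurTateTeitelbaum1986Invent, §I.13] -/
theorem constantCoeff_klTwoNumerator :
    PowerSeries.constantCoeff klTwoNumerator =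
      ∑ u : (ZMod (2 ^ cyclotomicExponent 2))ˣ, klTwoMeasure (cyclotomicExponent 2) u :=
  constantCoeff_distributionTransform klTwoMeasure_distribution

/-- **`G^ι(0) = (χ₋₄E_{1,5})ˇ(ℤ₂^×)`.** [cite: MazurTateTeitelbaum1986Invent, §I.13] -/
theorem constantCoeff_klTwoNumeratorInv :
    PowerSeries.constantCoeff klTwoNumeratorInv =
      ∑ u : (ZMod (2 ^ cyclotomicExponent 2))ˣ, klTwoMeasureInv (cyclotomicExponent 2) u :=
  constantCoeff_distributionTransform klTwoMeasureInv_distribution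

end KubotaLeopoldtTwo

/-! ## §5 At `p = 2`: `χ₋₄E_{1,5}` is even, `Δ = {±1}` doubles the Riemann sums — `G, G^ι ∈ 2Λ`,
`G(0) = G^ι(0) = 2` -/

section EvenAtTwo

/-! ### `E_{1,c}` and `χ₋₄` are odd, so `χ₋₄E_{1,5}` is even -/

/-- `E_1^{(M)}(−b) = −E_1^{(M)}(b)` for `b ≠ 0` (`B_1(1 − X) = −B_1(X)`, Lang **B 2**: `B_1(X) = X − ½`).
[cite: LangCyclotomic1990, Ch. 2 §2, B 2 (PDF p. 39)] -/
theorem bernoulliDist_one_neg {M : ℕ} [NeZero M] {b : ZMod M} (hb : b ≠ 0) :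
    bernoulliDist 1 M (-b) = -bernoulliDist 1 M b := by
  unfold bernoulliDist
  rw [ZMod.neg_val, if_neg hb, Nat.cast_sub (ZMod.val_lt b).le]
  have hM : (M : ℚ) ≠ 0 := by exact_mod_cast NeZero.ne M
  simp only [Nat.sub_self, pow_zero, one_mul, Polynomial.bernoulli_one, Polynomial.eval_sub,
    Polynomial.eval_X, Polynomial.eval_C]
  field_simp
  ring

/-- `E_{1,c}^{(M)}(−b) = −E_{1,c}^{(M)}(b)` for `b ≠ 0` and `c` prime to `M`.
[cite: LangCyclotomic1990, Ch. 2 §2, E_{1,c} = E_1 − cE_1∘c⁻¹ and B 2 (PDF pp. 39–41)] -/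
theorem regBernoulliDist_one_neg {M c : ℕ} [NeZero M] (hc : c.Coprime M) {b : ZMod M}
    (hb : b ≠ 0) : regBernoulliDist 1 M c (-b) = -regBernoulliDist 1 M c b := by
  unfold regBernoulliDist
  have hb' : b * (c : ZMod M)⁻¹ ≠ 0 := by
    intro h
    apply hb
    calc b = b * ((c : ZMod M) * (c : ZMod M)⁻¹) := by rw [ZMod.coe_mul_inv_eq_one c hc, mul_one]
      _ = b * (c : ZMod M)⁻¹ * (c : ZMod M) := by ring
      _ = 0 := by rw [h, zero_mul]
  rw [neg_mul, bernoulliDist_one_neg hb, bernoulliDist_one_neg hb', pow_one]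
  ring

/-- `χ₋₄` is odd: `χ₋₄(M − v) = −χ₋₄(v)` for `4 ∣ M`, `v ≤ M`.
[cite: LangCyclotomic1990, Ch. 2 §2 (characters on Z(m)^*, PDF p. 36) (unfolding of Mathlib's `ZMod.χ₄`)] -/
theorem chiMinusFour_sub_of_four_dvd (p : ℕ) [Fact p.Prime] {M v : ℕ} (hM : 4 ∣ M)
    (hv : v ≤ M) : chiMinusFour p (M - v) = -chiMinusFour p v := by
  rw [chiMinusFour_eq_ite, chiMinusFour_eq_ite]
  obtain ⟨m, rfl⟩ := hM
  rcases (by omega : v % 4 = 0 ∨ v % 4 = 1 ∨ v % 4 = 2 ∨ v % 4 = 3) with h | h | h | h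
  · have h' : (4 * m - v) % 4 = 0 := by omega
    simp [h, h']
  · have h' : (4 * m - v) % 4 = 3 := by omega
    simp [h, h']
  · have h' : (4 * m - v) % 4 = 2 := by omega
    simp [h, h']
  · have h' : (4 * m - v) % 4 = 1 := by omega
    simp [h, h']

/-- `5` is prime to `4·2ⁿ`. [cite: LangCyclotomic1990, Ch. 4 §3 (c prime to Np, PDF p. 84)] -/
private theorem coprime_five_level (n : ℕ) : (5 : ℕ).Coprime (4 * 2 ^ n) :=
  Nat.Coprime.mul_right (by norm_num) (Nat.Coprime.pow_right n (by norm_num))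

/-- The summand `χ₋₄(b)E_{1,5}^{(4·2ⁿ)}(b)` of `klTwoMeasure` is an even function of `b ∈ ℤ/4·2ⁿ`
(odd × odd; at `b = 0` trivially). [cite: LangCyclotomic1990, Ch. 2 §2 (PDF pp. 39–41) and Ch. 4 §3 (PDF p. 84)] -/
private theorem klTwo_summand_neg (n : ℕ) (b : ZMod (4 * 2 ^ n)) :
    ((chiMinusFour 2 (-b).val : ℤ_[2]) : ℚ_[2]) *
        ((regBernoulliDist 1 (4 * 2 ^ n) 5 (-b) / ((1 : ℕ) : ℚ) : ℚ) : ℚ_[2]) =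
      ((chiMinusFour 2 b.val : ℤ_[2]) : ℚ_[2]) *
        ((regBernoulliDist 1 (4 * 2 ^ n) 5 b / ((1 : ℕ) : ℚ) : ℚ) : ℚ_[2]) := by
  haveI : NeZero (4 * 2 ^ n) := ⟨by positivity⟩
  rcases eq_or_ne b 0 with rfl | hb
  · rw [neg_zero]
  have hχ : chiMinusFour 2 (-b).val = -chiMinusFour 2 b.val := by
    rw [ZMod.neg_val, if_neg hb]
    exact chiMinusFour_sub_of_four_dvd 2 (dvd_mul_right 4 _) (ZMod.val_lt b).le
  rw [hχ, regBernoulliDist_one_neg (coprime_five_level n) hb]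
  push_cast
  ring

/-- **The measure `χ₋₄E_{1,5}` is even**: `μ(−a + 2ⁿℤ₂) = μ(a + 2ⁿℤ₂)` (`χ₋₄` and `E_{1,5}` are both
odd). [cite: LangCyclotomic1990, Ch. 2 §2 (E_{1,c}, B 2; PDF pp. 39–41) and Ch. 4 §3 (χE_{1,c}, PDF p. 84)] -/
theorem klTwoMeasure_neg (n : ℕ) (a : ZMod (2 ^ n)) : klTwoMeasure n (-a) = klTwoMeasure n a := by
  rw [klTwoMeasure_apply, klTwoMeasure_apply]
  unfold bernoulliMeasure
  rw [Finset.sum_filter, Finset.sum_filter]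
  conv_lhs => rw [← Equiv.sum_comp (Equiv.neg (ZMod (4 * 2 ^ n)))]
  refine Finset.sum_congr rfl fun b _ ↦ ?_
  simp only [Equiv.neg_apply, map_neg, neg_inj]
  split_ifs
  · exact klTwo_summand_neg n b
  · rfl

/-- **The inverted measure `(χ₋₄E_{1,5})ˇ` is even** (`(−a)⁻¹ = −a⁻¹`).
[cite: LangCyclotomic1990, Ch. 4 §2 (operations on measures, PDF pp. 80–82)] -/
theorem klTwoMeasureInv_neg (n : ℕ) (a : ZMod (2 ^ n)) :
    klTwoMeasureInv n (-a) = klTwoMeasureInv n a := by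
  by_cases ha : IsUnit a
  · have hna : IsUnit (-a) := ha.neg
    have hu : hna.unit = -ha.unit :=
      Units.ext (by rw [Units.val_neg, hna.unit_spec, ha.unit_spec])
    have hinv : (-ha.unit)⁻¹ = -ha.unit⁻¹ :=
      inv_eq_of_mul_eq_one_right (by rw [neg_mul_neg, mul_inv_cancel])
    simp only [klTwoMeasureInv, invUnitsDist, dif_pos ha, dif_pos hna, hu, hinv, Units.val_neg,
      klTwoMeasure_neg]
  · have hna : ¬ IsUnit (-a) := fun h ↦ ha (neg_neg a ▸ h.neg)
    rw [klTwoMeasureInv_apply_of_not_isUnit ha, klTwoMeasureInv_apply_of_not_isUnit hna]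

/-! ### `Δ = {±1}` at `p = 2`: the Riemann sums of an even set function are twice their `η = 1` half -/

/-- `#Δ = φ(4) = 2` at `p = 2`. [cite: MazurTateTeitelbaum1986Invent, §I.13 (p = 2)] -/
private theorem torsionOrder_two_eq : torsionOrder 2 = 2 := by
  simp only [torsionOrder, cyclotomicExponent, if_true]
  decide

/-- The `2`-adic roots of unity of order dividing `2` are `±1`. [cite: MazurTateTeitelbaum1986Invent, §I.13 (p = 2, Δ = {±1})] -/
private theorem coe_rootsOfUnity_two (ξ : rootsOfUnity 2 ℤ_[2]) :
    ((ξ : ℤ_[2]ˣ) : ℤ_[2]) = 1 ∨ ((ξ : ℤ_[2]ˣ) : ℤ_[2]) = -1 := by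
  have h := ξ.2
  rw [mem_rootsOfUnity] at h
  have h' : (((ξ : ℤ_[2]ˣ) : ℤ_[2])) ^ 2 = 1 := by
    rw [← Units.val_pow_eq_pow_val, h, Units.val_one]
  exact sq_eq_one_iff.mp h'

/-- **At `p = 2` the Riemann sums of an EVEN set function are `2 ×` their `η = 1` half**:
`RS_μ(k, n) = 2·∑_{s mod 2ⁿ} μ(5^s + 2^{n+2}ℤ₂)·(s choose k)` (`Δ = {±1}`, `μ(−x) = μ(x)`).
[cite: MazurTateTeitelbaum1986Invent, §I.13 (p = 2: Δ = {±1}, γ = 5)] -/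
theorem distributionRiemannSum_two_of_even {μ : (n : ℕ) → ZMod (2 ^ n) → ℚ_[2]}
    (hμ : ∀ (n : ℕ) (a : ZMod (2 ^ n)), μ n (-a) = μ n a) (k n : ℕ) :
    distributionRiemannSum μ k n =
      2 * ∑ s : ZMod (2 ^ n), μ (n + 2) ((cyclotomicGenerator 2 : ZMod (2 ^ (n + 2))) ^ s.val) *
        ((s.val.choose k : ℕ) : ℚ_[2]) := by
  set G : ℤ_[2] → ℚ_[2] := fun x ↦ ∑ s : ZMod (2 ^ n),
      μ (n + 2) (PadicInt.toZModPow (n + 2) x *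
          (cyclotomicGenerator 2 : ZMod (2 ^ (n + 2))) ^ s.val) *
        ((s.val.choose k : ℕ) : ℚ_[2]) with hG
  have hG1 : G 1 = ∑ s : ZMod (2 ^ n),
      μ (n + 2) ((cyclotomicGenerator 2 : ZMod (2 ^ (n + 2))) ^ s.val) *
        ((s.val.choose k : ℕ) : ℚ_[2]) := by
    simp only [hG, map_one, one_mul]
  have hGneg : G (-1) = G 1 := by
    simp only [hG, map_neg, map_one, neg_one_mul, one_mul, hμ]
  -- the torsion group at `2` is `{1, ζ}` with `ζ = -1`
  have hζmem : (-1 : ℤ_[2]ˣ) ∈ rootsOfUnity 2 ℤ_[2] := by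
    rw [mem_rootsOfUnity]; norm_num
  set ζ : rootsOfUnity 2 ℤ_[2] := ⟨-1, hζmem⟩ with hζ
  have hne : (1 : rootsOfUnity 2 ℤ_[2]) ≠ ζ := by
    intro h
    have h' : (((1 : rootsOfUnity 2 ℤ_[2]) : ℤ_[2]ˣ) : ℤ_[2]) = ((ζ : ℤ_[2]ˣ) : ℤ_[2]) := by
      rw [h]
    rw [hζ] at h'
    simp only [OneMemClass.coe_one, Units.val_one, Units.val_neg] at h'
    have h2 : (2 : ℤ_[2]) = 0 := by linear_combination h'
    exact two_ne_zero h2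
  haveI : Fintype (rootsOfUnity 2 ℤ_[2]) := Fintype.ofFinite _
  have huniv : (Finset.univ : Finset (rootsOfUnity 2 ℤ_[2])) = {1, ζ} := by
    ext ξ
    simp only [Finset.mem_univ, Finset.mem_insert, Finset.mem_singleton, true_iff]
    rcases coe_rootsOfUnity_two ξ with h | h
    · left
      exact Subtype.ext (Units.ext (by simpa using h))
    · right
      exact Subtype.ext (Units.ext (by rw [hζ]; simpa using h))
  have hθ : distributionRiemannSum μ k n =
      ∑ᶠ ξ : rootsOfUnity (torsionOrder 2) ℤ_[2], G ((ξ : ℤ_[2]ˣ) : ℤ_[2]) := by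
    rw [distributionRiemannSum]
    rfl
  rw [hθ, torsionOrder_two_eq, finsum_eq_sum_of_fintype, huniv, Finset.sum_pair hne]
  simp only [OneMemClass.coe_one, Units.val_one, hζ, Units.val_neg]
  rw [hGneg, hG1, two_mul]

/-- **Coefficient bound halved for even distributions at `p = 2`**: if `μ` is an even bounded
distribution on `ℤ₂` with `‖μ‖ ≤ C`, then `‖[T^k] L_μ‖₂ ≤ C/2` (`RS = 2·(half-sum)`, `‖2‖₂ = ½`,
each half-sum has norm `≤ C`, and the coefficient is the limit).
[cite: MazurTateTeitelbaum1986Invent, §I.12–I.13 (p = 2)] -/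
theorem norm_coeff_distributionTransform_le_half_of_even {μ : (n : ℕ) → ZMod (2 ^ n) → ℚ_[2]}
    (hμ : ∀ (n : ℕ) (a : ZMod (2 ^ n)), μ n (-a) = μ n a)
    (hdist : ∀ (n : ℕ) (a : ZMod (2 ^ n)),
      ∑ b ∈ Finset.univ.filter (fun b : ZMod (2 ^ (n + 1)) ↦
        ZMod.castHom (pow_dvd_pow 2 n.le_succ) (ZMod (2 ^ n)) b = a), μ (n + 1) b = μ n a)
    {C : ℝ} (hC : ∀ (n : ℕ) (a : ZMod (2 ^ n)), ‖μ n a‖ ≤ C) (k : ℕ) :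
    ‖PowerSeries.coeff k (distributionTransform μ)‖ ≤ C / 2 := by
  have hC0 : 0 ≤ C := (norm_nonneg _).trans (hC 0 0)
  have h2 : ‖(2 : ℚ_[2])‖ = 2⁻¹ := by
    have h := @Padic.norm_p 2 _
    push_cast at h
    exact h
  have hRS : ∀ n, ‖distributionRiemannSum μ k n‖ ≤ C / 2 := fun n ↦ by
    rw [distributionRiemannSum_two_of_even hμ, norm_mul, h2]
    have h : ‖∑ s : ZMod (2 ^ n), μ (n + 2) ((cyclotomicGenerator 2 : ZMod (2 ^ (n + 2))) ^ s.val) *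
        ((s.val.choose k : ℕ) : ℚ_[2])‖ ≤ C :=
      IsUltrametricDist.norm_sum_le_of_forall_le_of_nonneg hC0 fun s _ ↦ by
        rw [norm_mul]
        have h1 : ‖((s.val.choose k : ℕ) : ℚ_[2])‖ ≤ 1 := by
          exact_mod_cast Padic.norm_int_le_one ((s.val.choose k : ℕ) : ℤ)
        calc ‖μ (n + 2) _‖ * ‖((s.val.choose k : ℕ) : ℚ_[2])‖ ≤ C * 1 :=
              mul_le_mul (hC _ _) h1 (norm_nonneg _) hC0
          _ = C := mul_one C
    calc (2 : ℝ)⁻¹ * _ ≤ 2⁻¹ * C := by gcongr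
      _ = C / 2 := by ring
  exact le_of_tendsto (tendsto_distributionRiemannSum hdist hC k).norm (Eventually.of_forall hRS)

/-- **`‖[T^k] G‖₂ ≤ ½` for every `k`: `G ∈ 2Λ`, i.e. `½G ∈ ℤ₂⟦T⟧`** (the `η = ±1` halves of every
Riemann sum agree). [cite: MazurTateTeitelbaum1986Invent, §I.12–I.13 (p = 2)] -/
theorem norm_coeff_klTwoNumerator_le_half (k : ℕ) :
    ‖PowerSeries.coeff k klTwoNumerator‖ ≤ 2⁻¹ := by
  have h := norm_coeff_distributionTransform_le_half_of_even klTwoMeasure_neg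
    klTwoMeasure_distribution norm_klTwoMeasure_le_one k
  rw [one_div] at h
  exact h

/-- **`‖[T^k] G^ι‖₂ ≤ ½` for every `k`: `½G^ι ∈ ℤ₂⟦T⟧`.** [cite: MazurTateTeitelbaum1986Invent, §I.12–I.13 (p = 2)] -/
theorem norm_coeff_klTwoNumeratorInv_le_half (k : ℕ) :
    ‖PowerSeries.coeff k klTwoNumeratorInv‖ ≤ 2⁻¹ := by
  have h := norm_coeff_distributionTransform_le_half_of_even klTwoMeasureInv_neg
    klTwoMeasureInv_distribution norm_klTwoMeasureInv_le_one k
  rw [one_div] at h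
  exact h

/-! ### The constant terms: `G(0) = G^ι(0) = 2` -/

/-- `E_{1,5}^{(4)}(1) = 1` (`5 ≡ 1 (mod 4)`, `E_{1,5}^{(4)}(b) = B_1(b/4) − 5B_1(b/4) = 2 − b` on
representatives). [cite: LangCyclotomic1990, Ch. 2 §2, E 1 (PDF p. 41)] -/
private theorem regBernoulliDist_one_four_five_one : regBernoulliDist 1 4 5 (1 : ZMod 4) = 1 := by
  have h1 : ((1 : ZMod 4) * ((5 : ℕ) : ZMod 4)⁻¹).val = 1 := by
    rw [show ((5 : ℕ) : ZMod 4) = 1 from by decide, ZMod.inv_one, mul_one]; decide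
  have h2 : (1 : ZMod 4).val = 1 := by decide
  simp only [regBernoulliDist, bernoulliDist, h1, h2, Polynomial.bernoulli_one, Polynomial.eval_sub,
    Polynomial.eval_X, Polynomial.eval_C]
  norm_num

/-- `E_{1,5}^{(4)}(3) = −1`. [cite: LangCyclotomic1990, Ch. 2 §2, E 1 (PDF p. 41)] -/
private theorem regBernoulliDist_one_four_five_three :
    regBernoulliDist 1 4 5 (3 : ZMod 4) = -1 := by
  have h1 : ((3 : ZMod 4) * ((5 : ℕ) : ZMod 4)⁻¹).val = 3 := by
    rw [show ((5 : ℕ) : ZMod 4) = 1 from by decide, ZMod.inv_one, mul_one]; decide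
  have h2 : (3 : ZMod 4).val = 3 := by decide
  simp only [regBernoulliDist, bernoulliDist, h1, h2, Polynomial.bernoulli_one, Polynomial.eval_sub,
    Polynomial.eval_X, Polynomial.eval_C]
  norm_num

/-- **Total mass `(χ₋₄E_{1,5})(ℤ₂) = 2`**: at level `0`,
`μ(ℤ₂) = ∑_{b mod 4} χ₋₄(b)E_{1,5}^{(4)}(b) = E_{1,5}^{(4)}(1) − E_{1,5}^{(4)}(3) = 1 − (−1) = 2`.
[cite: LangCyclotomic1990, Ch. 2 §2, E 1 (PDF p. 41) and Ch. 4 §3 (PDF p. 84)] -/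
theorem klTwoMeasure_zero : klTwoMeasure 0 (0 : ZMod (2 ^ 0)) = 2 := by
  rw [klTwoMeasure_apply]
  unfold bernoulliMeasure
  haveI : Subsingleton (ZMod (2 ^ 0)) := ZMod.subsingleton_iff.2 (by norm_num)
  rw [Finset.filter_true_of_mem (fun b _ ↦ Subsingleton.elim _ _)]
  -- the sum over `ℤ/4·2⁰ = ℤ/4`
  show ∑ b : ZMod 4, ((chiMinusFour 2 b.val : ℤ_[2]) : ℚ_[2]) *
      ((regBernoulliDist 1 4 5 b / ((1 : ℕ) : ℚ) : ℚ) : ℚ_[2]) = 2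
  have huniv : (Finset.univ : Finset (ZMod 4)) = {0, 1, 2, 3} := by decide
  rw [huniv, Finset.sum_insert (by decide), Finset.sum_insert (by decide),
    Finset.sum_pair (by decide)]
  have h0 : (0 : ZMod 4).val = 0 := by decide
  have h1 : (1 : ZMod 4).val = 1 := by decide
  have h2 : (2 : ZMod 4).val = 2 := by decide
  have h3 : (3 : ZMod 4).val = 3 := by decide
  simp only [chiMinusFour_eq_ite, h0, h1, h2, h3, regBernoulliDist_one_four_five_one,
    regBernoulliDist_one_four_five_three]
  norm_num

/-- `μ(2ℤ₂) = 0` at level `1` (a non-unit class). [cite: LangCyclotomic1990, Ch. 4 §3 (χ extended by 0, PDF p. 84)] -/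
private theorem klTwoMeasure_one_zero : klTwoMeasure 1 (0 : ZMod (2 ^ 1)) = 0 := by
  haveI : Fact (1 < 2 ^ 1) := ⟨by norm_num⟩
  exact klTwoMeasure_eq_zero_of_not_isUnit le_rfl 0 not_isUnit_zero

/-- `μ(1 + 2ℤ₂) = μ(ℤ₂) = 2` (distribution relation at level `0` and `μ(2ℤ₂) = 0`).
[cite: LangCyclotomic1990, Ch. 2 §2 (distribution relation) and Ch. 4 §3 (PDF p. 84)] -/
private theorem klTwoMeasure_one_one : klTwoMeasure 1 (1 : ZMod (2 ^ 1)) = 2 := by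
  have h := klTwoMeasure_distribution 0 (0 : ZMod (2 ^ 0))
  haveI : Subsingleton (ZMod (2 ^ 0)) := ZMod.subsingleton_iff.2 (by norm_num)
  rw [Finset.filter_true_of_mem (fun b _ ↦ Subsingleton.elim _ _), klTwoMeasure_zero] at h
  have huniv : (Finset.univ : Finset (ZMod (2 ^ (0 + 1)))) = {0, 1} := by decide
  rw [huniv, Finset.sum_pair (by decide)] at h
  have h0 : klTwoMeasure (0 + 1) (0 : ZMod (2 ^ (0 + 1))) = 0 := klTwoMeasure_one_zero
  rw [h0, zero_add] at h
  exact h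

/-- **`μ(1 + 4ℤ₂) = 1`**: `μ(1 + 4ℤ₂) + μ(3 + 4ℤ₂) = μ(1 + 2ℤ₂) = 2` and `μ(3 + 4ℤ₂) = μ(−1 + 4ℤ₂) = μ(1 + 4ℤ₂)`
(evenness). [cite: LangCyclotomic1990, Ch. 2 §2 (distribution relation, E 1) and Ch. 4 §3 (PDF p. 84)] -/
theorem klTwoMeasure_two_one : klTwoMeasure 2 (1 : ZMod (2 ^ 2)) = 1 := by
  have h := klTwoMeasure_distribution 1 (1 : ZMod (2 ^ 1))
  rw [klTwoMeasure_one_one] at h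
  have hfil : (Finset.univ.filter fun b : ZMod (2 ^ (1 + 1)) ↦
      ZMod.castHom (pow_dvd_pow 2 (1 : ℕ).le_succ) (ZMod (2 ^ 1)) b = 1) = {1, -1} := by
    decide
  rw [hfil, Finset.sum_pair (by decide), klTwoMeasure_neg] at h
  have h2 : (2 : ℚ_[2]) * klTwoMeasure 2 1 = 2 := by rw [two_mul]; exact h
  have h2' : (2 : ℚ_[2]) ≠ 0 := two_ne_zero
  calc klTwoMeasure 2 1 = 2⁻¹ * (2 * klTwoMeasure 2 1) := by rw [← mul_assoc, inv_mul_cancel₀ h2', one_mul]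
    _ = 1 := by rw [h2, inv_mul_cancel₀ h2']

/-- **`G(0) = 2`** (so `½G` has constant term `1`, a unit): `G(0) = RS(0, 0) = 2·μ(1 + 4ℤ₂) = 2`.
[cite: MazurTateTeitelbaum1986Invent, §I.13 (constant term = μ(ℤ_p^×); p = 2)]
[cite: LangCyclotomic1990, Ch. 2 §2, E 1 (PDF p. 41)] -/
theorem constantCoeff_klTwoNumerator_eq_two : PowerSeries.constantCoeff klTwoNumerator = 2 := by
  have h1 : PowerSeries.constantCoeff klTwoNumerator = distributionRiemannSum klTwoMeasure 0 0 := by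
    rw [constantCoeff_klTwoNumerator]
    exact (riemannSum_zero_of_distribution (distributionRiemannSum_spec klTwoMeasure)
      klTwoMeasure_distribution 0).symm
  rw [h1, distributionRiemannSum_two_of_even klTwoMeasure_neg 0 0]
  haveI : Subsingleton (ZMod (2 ^ 0)) := ZMod.subsingleton_iff.2 (by norm_num)
  rw [Fintype.sum_subsingleton _ (0 : ZMod (2 ^ 0))]
  rw [ZMod.val_zero, pow_zero, Nat.choose_zero_right, Nat.cast_one, mul_one]
  rw [klTwoMeasure_two_one]; norm_num

/-- **`G^ι(0) = 2`**: `G^ι(0) = RSˇ(0, 0) = 2·μ̌(1 + 4ℤ₂) = 2·μ(1 + 4ℤ₂) = 2`.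
[cite: MazurTateTeitelbaum1986Invent, §I.13 (constant term = μ(ℤ_p^×); p = 2)]
[cite: LangCyclotomic1990, Ch. 4 §2 (PDF pp. 80–82) and Ch. 2 §2, E 1 (PDF p. 41)] -/
theorem constantCoeff_klTwoNumeratorInv_eq_two :
    PowerSeries.constantCoeff klTwoNumeratorInv = 2 := by
  have h1 : PowerSeries.constantCoeff klTwoNumeratorInv =
      distributionRiemannSum klTwoMeasureInv 0 0 := by
    rw [constantCoeff_klTwoNumeratorInv]
    exact (riemannSum_zero_of_distribution (distributionRiemannSum_spec klTwoMeasureInv)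
      klTwoMeasureInv_distribution 0).symm
  rw [h1, distributionRiemannSum_two_of_even klTwoMeasureInv_neg 0 0]
  haveI : Subsingleton (ZMod (2 ^ 0)) := ZMod.subsingleton_iff.2 (by norm_num)
  rw [Fintype.sum_subsingleton _ (0 : ZMod (2 ^ 0))]
  rw [ZMod.val_zero, pow_zero, Nat.choose_zero_right, Nat.cast_one, mul_one,
    klTwoMeasureInv_apply_of_isUnit isUnit_one, ZMod.inv_one, klTwoMeasure_two_one]
  norm_num

/-! ### `½G, ½G^ι ∈ Λ = ℤ₂⟦T⟧` with constant term `1` (the shape consumed Summit-side) -/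

/-- `‖2‖₂ = ½`. [cite: MazurTateTeitelbaum1986Invent, §I.12 (unfolding)] -/
private theorem norm_two_eq_half : ‖(2 : ℚ_[2])‖ = 2⁻¹ := by
  have h := @Padic.norm_p 2 _
  push_cast at h
  exact h

/-- A power series `L ∈ ℚ₂⟦T⟧` with `‖[T^k] L‖₂ ≤ ½` for all `k` and `L(0) = 2` is `2·ι(G₀)` for a
`G₀ ∈ Λ = ℤ₂⟦T⟧` with `G₀(0) = 1` (coefficientwise division by `2`; MTT §I.12: `Λ ⊗ ℚ` = bounded
power series). [cite: MazurTateTeitelbaum1986Invent, §I.12] -/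
private theorem exists_iwasawa_half_of_norm_le_half {L : PowerSeries ℚ_[2]}
    (hL : ∀ k : ℕ, ‖PowerSeries.coeff k L‖ ≤ 2⁻¹) (h0 : PowerSeries.constantCoeff L = 2) :
    ∃ G₀ : IwasawaAlgebra 2,
      iwasawaToPowerSeries 2 G₀ = PowerSeries.C (2⁻¹ : ℚ_[2]) * L ∧
        PowerSeries.constantCoeff G₀ = 1 := by
  have hint : ∀ k : ℕ, ‖(2⁻¹ : ℚ_[2]) * PowerSeries.coeff k L‖ ≤ 1 := fun k ↦ by
    rw [norm_mul, norm_inv, norm_two_eq_half, inv_inv]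
    calc (2 : ℝ) * ‖PowerSeries.coeff k L‖ ≤ 2 * 2⁻¹ :=
          mul_le_mul_of_nonneg_left (hL k) (by norm_num)
      _ = 1 := by norm_num
  refine ⟨PowerSeries.mk fun k ↦ ⟨(2⁻¹ : ℚ_[2]) * PowerSeries.coeff k L, hint k⟩, ?_, ?_⟩
  · ext k
    rw [PowerSeries.coeff_C_mul]
    simp [PowerSeries.coeff_map]
  · rw [← PowerSeries.coeff_zero_eq_constantCoeff_apply, PowerSeries.coeff_mk]
    rw [← PowerSeries.coeff_zero_eq_constantCoeff_apply] at h0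
    apply Subtype.ext
    show (2⁻¹ : ℚ_[2]) * PowerSeries.coeff 0 L = ((1 : ℤ_[2]) : ℚ_[2])
    rw [h0, PadicInt.coe_one]
    norm_num

/-- **`½G ∈ Λ` with constant term `1`**: there is `G₀ ∈ ℤ₂⟦T⟧` with `ι(G₀) = ½·G` in `ℚ₂⟦T⟧` and
`G₀(0) = 1` — so `G = 2·ι(G₀)` is a nonzero rational multiple of an element of `Λ` of `μ`-invariant
`0` and unit constant term (the input (K) of the mod-2 Eisenstein identity at `2`).
[cite: MazurTateTeitelbaum1986Invent, §I.12–I.13 (p = 2)] [cite: LangCyclotomic1990, Ch. 4 §3 (PDF p. 84)] -/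
theorem exists_iwasawa_half_klTwoNumerator :
    ∃ G₀ : IwasawaAlgebra 2,
      iwasawaToPowerSeries 2 G₀ = PowerSeries.C (2⁻¹ : ℚ_[2]) * klTwoNumerator ∧
        PowerSeries.constantCoeff G₀ = 1 :=
  exists_iwasawa_half_of_norm_le_half norm_coeff_klTwoNumerator_le_half
    constantCoeff_klTwoNumerator_eq_two

/-- **`½G^ι ∈ Λ` with constant term `1`.**
[cite: MazurTateTeitelbaum1986Invent, §I.12–I.13 (p = 2)] [cite: LangCyclotomic1990, Ch. 4 §2–§3 (PDF pp. 80–84)] -/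
theorem exists_iwasawa_half_klTwoNumeratorInv :
    ∃ G₀ : IwasawaAlgebra 2,
      iwasawaToPowerSeries 2 G₀ = PowerSeries.C (2⁻¹ : ℚ_[2]) * klTwoNumeratorInv ∧
        PowerSeries.constantCoeff G₀ = 1 :=
  exists_iwasawa_half_of_norm_le_half norm_coeff_klTwoNumeratorInv_le_half
    constantCoeff_klTwoNumeratorInv_eq_two

end EvenAtTwo

end Literature.NumberTheory.EllipticCurves

end
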